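import Literature.Probability.LatticeModels.DelaunayGraph
import HarnessLib

/-!
# Locality of Delaunay adjacency on the no-void event (one-arm route, lead c3)

Line `moebius-exact-delaunay-dilation-ward` of crux `VoronoiHubFromSmirnov` (stmt-CriticalPhenomena-6433).
A registered `--supports` brick used by L1 (domain ↔ window adjacency) and Pr1a (localising a
defect pair before applying Benjamini–Schramm's Lemma 4.2): if `p, q` are Delaunay-adjacent with
respect to a SUB-configuration `S₀ ⊆ S` that has no void of radius `t` within `2t` of `p`, and every
nucleus of `S` outside `S₀` is farther than `2t` from `p`, then the witnessing empty disc has radius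
`≤ t` and `p, q` are Delaunay-adjacent with respect to all of `S`.  Converse direction
(`IsDelaunayPair.anti`) is in the Literature file.
-/

namespace Summit.CriticalPhenomena.CardyFormulaZ2.Cruxes.VoronoiHubFromSmirnov.MoebiusExactDelaunayDilationWard

open Metric Set
open Literature.Probability.LatticeModels (IsDelaunayPair)

/-- **Empty circumdiscs are small where there are no voids.**  If `p, q` lie on a circle of centre
`c` and radius `r = dist p c` whose open disc contains no point of `S₀`, and every point within `2t`
of `p` has a point of `S₀` at distance `< t` (`0 < t`), then `r ≤ t`. -/
theorem circumradius_le_of_noVoid {S₀ : Set ℂ} {p c : ℂ} {t : ℝ} (ht : 0 < t)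
    (hempty : ∀ z ∈ S₀, dist p c ≤ dist z c)
    (hvoid : ∀ w : ℂ, dist w p ≤ 2 * t → ∃ y ∈ S₀, dist y w < t) : dist p c ≤ t := by
  by_contra hlt
  push Not at hlt
  set r : ℝ := dist p c with hr
  have hr0 : 0 < r := ht.trans hlt
  have hpc : p ≠ c := by
    intro h; rw [h, dist_self] at hr; exact (lt_irrefl (0 : ℝ)) (hr ▸ hr0)
  -- the point `w` on the segment from `p` towards `c` at distance `t` from `p`
  set w : ℂ := p + ((t / r : ℝ) : ℂ) * (c - p) with hw
  have hnorm : ‖c - p‖ = r := by rw [hr, dist_eq_norm, ← norm_neg, neg_sub]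
  have hwp : dist w p = t := by
    rw [dist_eq_norm, hw, add_sub_cancel_left, norm_mul, Complex.norm_real, Real.norm_eq_abs,
      abs_of_pos (div_pos ht hr0), hnorm, div_mul_cancel₀ _ hr0.ne']
  have hwc : dist w c = r - t := by
    have : w - c = ((1 - t / r : ℝ) : ℂ) * (p - c) := by
      rw [hw]; push_cast; ring
    rw [dist_eq_norm, this, norm_mul, Complex.norm_real, Real.norm_eq_abs,
      abs_of_pos (by rw [sub_pos, div_lt_one hr0]; exact hlt), ← dist_eq_norm, ← hr]
    field_simp
  obtain ⟨y, hy, hyw⟩ := hvoid w (by rw [hwp]; linarith)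
  have h1 : dist y c < r := by
    calc dist y c ≤ dist y w + dist w c := dist_triangle _ _ _
      _ < t + (r - t) := by rw [hwc]; exact add_lt_add_left hyw _
      _ = r := by ring
  exact (not_le.2 h1) (hempty y hy)

/-- **Locality of Delaunay adjacency (no-void form).**  Let `S₀ ⊆ S` be nucleus sets, `0 < t`.
If `p ~ q` in the Delaunay graph of `S₀`, `S₀` has no void of radius `t` within `2t` of `p`, and the
nuclei of `S` outside `S₀` are at distance `> 2t` from `p`, then `p ~ q` in the Delaunay graph of
`S` (the empty disc has radius `≤ t`, lies within `2t` of `p`, and so contains no nucleus of `S`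
either). -/
theorem isDelaunayPair_of_local : ∀ (S₀ S : Set ℂ) (p q : ℂ) (t : ℝ), 0 < t → S₀ ⊆ S → Literature.Probability.LatticeModels.IsDelaunayPair S₀ p q → (∀ w : ℂ, dist w p ≤ 2 * t → ∃ y ∈ S₀, dist y w < t) → (∀ y ∈ S, y ∉ S₀ → 2 * t < dist y p) → Literature.Probability.LatticeModels.IsDelaunayPair S p q := by
  intro S₀ S p q t ht _ hpq hvoid hfar
  obtain ⟨c, r, hpc, hqc, hempty⟩ := hpq
  have hempty' : ∀ z ∈ S₀, dist p c ≤ dist z c := fun z hz => hpc ▸ hempty z hz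
  have hrt : dist p c ≤ t := circumradius_le_of_noVoid ht hempty' hvoid
  refine ⟨c, r, hpc, hqc, fun z hz => ?_⟩
  by_cases hz0 : z ∈ S₀
  · exact hempty z hz0
  · have hfz := hfar z hz hz0
    rw [← hpc]
    -- `dist z c ≥ dist z p - dist p c > 2t - t = t ≥ dist p c`
    have := dist_triangle z c p
    rw [dist_comm c p] at this
    linarith

/-- The same with a bound on where the witnessing disc lies: under the no-void hypothesis alone, a
Delaunay pair of `S₀` through `p` has its partner within `2t` of `p`. -/
theorem dist_le_of_isDelaunayPair_noVoid {S₀ : Set ℂ} {p q : ℂ} {t : ℝ} (ht : 0 < t)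
    (hpq : IsDelaunayPair S₀ p q) (hvoid : ∀ w : ℂ, dist w p ≤ 2 * t → ∃ y ∈ S₀, dist y w < t) :
    dist q p ≤ 2 * t := by
  obtain ⟨c, r, hpc, hqc, hempty⟩ := hpq
  have hempty' : ∀ z ∈ S₀, dist p c ≤ dist z c := fun z hz => hpc ▸ hempty z hz
  have hrt : dist p c ≤ t := circumradius_le_of_noVoid ht hempty' hvoid
  calc dist q p ≤ dist q c + dist c p := dist_triangle _ _ _
    _ = dist p c + dist p c := by rw [hqc, ← hpc, dist_comm c p]
    _ ≤ 2 * t := by linarith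

end Summit.CriticalPhenomena.CardyFormulaZ2.Cruxes.VoronoiHubFromSmirnov.MoebiusExactDelaunayDilationWard
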